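/-
Copyright (c) 2026 the pub-hodgecm-mathlib formalisation cell (harness21).  Prover seat hodgecm-mathlib-LH4-p01 (g10): road M6 → F3 «TOT-Λ BY OVER-ORDERS» (LEAD F0P3a-plan
T14-66 ∕ T15-32 «GO-LOW»), brick F5-(0) v2-U «THE θ-PACKAGE OF THE UNIFORMISER ROW WITH ITS SECOND INVOLUTION» for the F3-5 ∕ F5 pen LH7-p04 (g12); 2026-09-03.
-/
import Literature.NumberTheory.Rogawski1990.InertPlaceThetaPackageUniformiser     -- ★ FILE C p853143 (this seat): `exists_thetaPackage_uniformiserRow`, `exists_isUnit_moved_by_galAdicCompletionMap`; brings ★ [T2-L] (L2)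
import Literature.NumberTheory.LocalFields.UnramifiedQuadraticNormAtInertPlace    -- ★ `exists_mul_galAdicCompletionMap_eq_of_inert` (unit norms at an inert place)
import Literature.NumberTheory.Automorphic.QuadraticFixedNormSupply                -- ★ (S2) p853117: `exists_mul_map_eq_of_valuation_eq`
import Literature.NumberTheory.Automorphic.UnitaryGroupSplitPlace                  -- ★ `algEquiv_mul_self_eq_one`
import HarnessLib

/-!
# The θ-package of the uniformiser row at an inert place, with the second involution `ι′` (`ι′θ = −θ`) and the gate's three dictionaries (rE) (nE) (θ − ι′θ)

Topic `NumberTheory/Rogawski1990`; namespace `Literature.NumberTheory.Rogawski1990`.  THEOREMS ONLY (no definition, no instance, no notation, no named fact, no `sorry`).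
Cell `pub/hodgecm-mathlib` (D-0151), crux H413 = `stmt-HodgeConjecture-24833`; road M6 → F3, brick **F5-(0) v2-U**: ★ FILE C `exists_thetaPackage_uniformiserRow` delivers, at an
inert CM place `w ∣ v` and a place `w₁ ∣ w` of the eigen-field `M = E(δ)`, `δ² = m`, `d⁻¹m ∈ (E_w^×)²` for a `σ_w`-fixed uniformiser `d`, the letters `d₀ θ s̃` of ★ (c5-ii) FILE A
(`θ = √d`, `s̃ ⊃ σ_w`, `s̃θ = θ`, coordinates, integrality, isometry, (nK)).  The F4 GATE (★ C8-odd `SymmetricEigenframe.gate_at_generator_uniform`) wants, for the SAME `θ` and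
`s̃`, the `E_w`-linear involution `ι′` of `M_{w₁}` with `ι′θ = −θ` (★ [T2-L] (L2) `exists_involutions_of_ramified`), isometric and commuting with `s̃`, and three dictionaries:
(rE) `ι′`-fixed elements have even order (they are `ι₁ p`, `|ι₁ p| = |p|²`); (nE) a `s̃`- and `ι′`-fixed `c` of order divisible by `4` is `ι₁(t·σ_w t)` — a `ι′`-FIXED `s̃`-norm
(`c = ι₁ p`, `σ_w p = p`, `ord p` even; `p·d^{−ord p}` is a `σ_w`-fixed unit, a norm at the INERT place by ★ `exists_mul_galAdicCompletionMap_eq_of_inert`, and `d^{2k} = d^k σ_w d^k` —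
★ (S2) `exists_mul_map_eq_of_valuation_eq`); and `|θ − ι′θ| = |2θ| = q^{−(2s+1)}` with `q^{−s} = |2|_w` (any residue characteristic).  This file EXPORTS them next to FILE C's
letters in ONE existential, so that F5 feeds ★ F5-(0) `ncard_isSelfDualLattice_stable_eq_phiTHn_inertPlace`'s `hgateV` from ★ C8-odd with one `obtain` (uniformiser row).
HONEST LABEL: HC_CM is proved only modulo the 2 remaining named inputs (hLiu418 24832, h413 24833) until rung 0 closes; assembly of ★ bricks, asserts nothing printed;
count-neutral (pays no organ; zero label movement until F5 ★ and a desk-priced rider).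

* **`exists_thetaPackage_uniformiserRow_involution`**.

## References
* [SerreLocalFields1979] J.-P. Serre, *Local Fields*, GTM 67 (1979): Ch. I §6 Prop. 17–18 (Eisenstein basis), Ch. V §2 Prop. 3 and Cor. (unit norms, unramified case), Ch. V §3.
* [Jacobowitz1962] R. Jacobowitz, *Hermitian forms over local fields*, Amer. J. Math. 84 (1962): §5 (norm groups at ramified ∕ unramified `K ∕ K₀`).
* [Rogawski1990] J. D. Rogawski, *Automorphic Representations of Unitary Groups in Three Variables*, Ann. of Math. Stud. 123 (1990): §4.9 Lemma 4.9.3 p. 56.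
-/

set_option autoImplicit false

noncomputable section

open ValuativeRel NumberField IsDedekindDomain
open scoped ValuativeRel
open Literature.NumberTheory.Automorphic Literature.NumberTheory.Automorphic.UnitaryGroup Literature.NumberTheory.NumberFields

namespace Literature.NumberTheory.Rogawski1990

/-- **THE θ-PACKAGE OF THE UNIFORMISER ROW WITH ITS SECOND INVOLUTION.**  ★ FILE C `exists_thetaPackage_uniformiserRow`'s sixteen letters (verbatim, same order) for `d₀ θ s̃`,
followed by: the involution `ι′` (`ι′ ∘ ι₁ = ι₁`, `ι′θ = −θ`, `ι′ι′ = 1`, `ι′𝒪 ⊆ 𝒪`, `|ι′z| = |z|`, `s̃ι′ = ι′s̃`); (rE) `x ≠ 0`, `ι′x = x` ⇒ `ord x` even; (nE) `c ≠ 0`, `s̃c = c`, `ι′c = c`,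
`4 ∣ ord c` ⇒ `∃ a, ι′a = a ∧ a·s̃a·c = 1`; and `∃ s, |θ − ι′θ| = q^{−(2s+1)}` (`q^{−s} = |2|_w`) — the `τ`-free package letters of ★ C8-odd `gate_at_generator_uniform` at the place.
[cite: SerreLocalFields1979, Ch. I §6 Prop. 17–18; Ch. V §2 Prop. 3, §3] [cite: Jacobowitz1962, §5] -/
theorem exists_thetaPackage_uniformiserRow_involution
    {F E : Type} [Field F] [NumberField F] [Field E] [NumberField E] [Algebra F E] [Algebra.IsQuadraticExtension F E]
    (c : E ≃ₐ[F] E) (v : HeightOneSpectrum (𝓞 F)) (hc : c ≠ 1) (hunr : Algebra.IsUnramifiedIn (𝓞 E) v.asIdeal)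
    (w : PlacesOver E v) (hw : c • w.1 = w.1)
    {M : Type} [Field M] [NumberField M] [Algebra E M] [Algebra.IsQuadraticExtension E M] (σM : M ≃ₐ[E] M) {δ : M} (hσδ : σM δ = -δ) (hδ : δ ≠ 0)
    {m : E} (hm : algebraMap E M m = δ ^ 2) {d : w.1.adicCompletion E} (hd : Valued.v d = WithZero.exp (-1 : ℤ))
    (hdm : IsSquare (d⁻¹ * (m : w.1.adicCompletion E))) (hσd : galAdicCompletionMap (L := E) c hw d = d) (w₁ : PlacesOver M w.1) :
    ∃ (d₀ : v.adicCompletion F) (θ : w₁.1.adicCompletion M) (s' ι' : w₁.1.adicCompletion M →+* w₁.1.adicCompletion M),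
      -- ★ FILE C's letters
      (toPlace v w d₀ = d ∧ Valued.v d₀ = WithZero.exp (-1 : ℤ) ∧ Valued.v (0 : v.adicCompletion F) < 1 ∧
      θ ^ 2 = toPlace w.1 w₁ (toPlace v w 0) * θ + toPlace w.1 w₁ (toPlace v w d₀) ∧ Valued.v θ = WithZero.exp (-1 : ℤ) ∧
      (∀ z : w₁.1.adicCompletion M, ∃! pq : w.1.adicCompletion E × w.1.adicCompletion E, z = toPlace w.1 w₁ pq.1 + toPlace w.1 w₁ pq.2 * θ) ∧
      (∀ p q : w.1.adicCompletion E, toPlace w.1 w₁ p + toPlace w.1 w₁ q * θ ∈ 𝒪[w₁.1.adicCompletion M] ↔ p ∈ 𝒪[w.1.adicCompletion E] ∧ q ∈ 𝒪[w.1.adicCompletion E]) ∧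
      (∀ x, s' (toPlace w.1 w₁ x) = toPlace w.1 w₁ (galAdicCompletionMap (L := E) c hw x)) ∧ s' θ = θ ∧ (∀ z, s' (s' z) = z) ∧
      (∀ z : 𝒪[w₁.1.adicCompletion M], s' z ∈ 𝒪[w₁.1.adicCompletion M]) ∧ (∀ z, Valued.v (s' z) = Valued.v z) ∧
      (∀ c₁ : w₁.1.adicCompletion M, c₁ ≠ 0 → s' c₁ = c₁ → Even (WithZero.log (Valued.v c₁)) → ∃ a : w₁.1.adicCompletion M, a * s' a * c₁ = 1)) ∧
      -- the second involution `ι′`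
      ((∀ x, ι' (toPlace w.1 w₁ x) = toPlace w.1 w₁ x) ∧ ι' θ = -θ ∧ (∀ z, ι' (ι' z) = z) ∧
        (∀ z : 𝒪[w₁.1.adicCompletion M], ι' z ∈ 𝒪[w₁.1.adicCompletion M]) ∧ (∀ z, Valued.v (ι' z) = Valued.v z) ∧ (∀ z, s' (ι' z) = ι' (s' z))) ∧
      -- (rE), (nE), `|θ − ι′θ|`
      (∀ x : w₁.1.adicCompletion M, x ≠ 0 → ι' x = x → Even (WithZero.log (Valued.v x))) ∧
      (∀ c₁ : w₁.1.adicCompletion M, c₁ ≠ 0 → s' c₁ = c₁ → ι' c₁ = c₁ → (4 : ℤ) ∣ WithZero.log (Valued.v c₁) →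
        ∃ a : w₁.1.adicCompletion M, ι' a = a ∧ a * s' a * c₁ = 1) ∧
      (∃ s : ℕ, Valued.v (θ - ι' θ) = WithZero.exp (-((2 * s + 1 : ℕ) : ℤ))) := by
  -- ### ★ FILE C
  obtain ⟨d₀, θ, s', hd₀, hd₀v, h0, hθ, hθv, hcoord, hint, hs'ι, hs'θ, hs's', hs'O, hs'v, hnorm1⟩ :=
    exists_thetaPackage_uniformiserRow c v hc hunr w hw σM hσδ hδ hm hd hdm hσd w₁
  -- the base involution `σ_w` and `e(w₁ ∣ w) = 2`
  have hss : ∀ x, galAdicCompletionMap (L := E) c hw (galAdicCompletionMap (L := E) c hw x) = x :=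
    galAdicCompletionMap_galAdicCompletionMap_of_smul_eq c w hc hw
  have hsO : ∀ x : 𝒪[w.1.adicCompletion E], galAdicCompletionMap (L := E) c hw x ∈ 𝒪[w.1.adicCompletion E] :=
    fun x => mem_integer_galAdicCompletionMap c v w hw x
  have hsv : ∀ x : w.1.adicCompletion E, Valued.v (galAdicCompletionMap (L := E) c hw x) = Valued.v x :=
    fun x => valued_galAdicCompletionMap (L := E) c hw x
  have he : (w.1).asIdeal.ramificationIdx' w₁.1.asIdeal = 2 := ramificationIdx'_eq_two_of_uniformizer M w.1 σM hσδ hδ hm hd hdm w₁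
  have hjv : ∀ p : w.1.adicCompletion E, Valued.v (toPlace w.1 w₁ p) = Valued.v p ^ 2 := valued_toPlace_of_ramificationIdx'_eq_two M w.1 w₁ he
  have hval : ∀ p q : w.1.adicCompletion E, Valued.v (toPlace w.1 w₁ p + toPlace w.1 w₁ q * θ) = max (Valued.v p ^ 2) (Valued.v q ^ 2 * WithZero.exp (-1 : ℤ)) :=
    valued_toPlace_add_toPlace_mul_of_ramified M w.1 w₁ he hθv
  -- ### ★ [T2-L] (L2): the involution `ι′` over the SAME `θ`
  have hθ' : θ ^ 2 = toPlace w.1 w₁ d := by rw [hθ, map_zero, map_zero, zero_mul, zero_add, hd₀]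
  obtain ⟨-, ι', hι'j, hι'θ, hι'ι', hι'O⟩ := exists_involutions_of_ramified M w.1 σM hσδ hδ hm hd hdm w₁ (galAdicCompletionMap (L := E) c hw) hss hσd hsO hθ'
  have hco : ∀ z : w₁.1.adicCompletion M, ∃ pq : w.1.adicCompletion E × w.1.adicCompletion E, z = toPlace w.1 w₁ pq.1 + toPlace w.1 w₁ pq.2 * θ :=
    fun z => (hcoord z).exists
  have hs'pq : ∀ p q : w.1.adicCompletion E, s' (toPlace w.1 w₁ p + toPlace w.1 w₁ q * θ) =
      toPlace w.1 w₁ (galAdicCompletionMap (L := E) c hw p) + toPlace w.1 w₁ (galAdicCompletionMap (L := E) c hw q) * θ := fun p q => by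
    rw [map_add, map_mul, hs'ι, hs'ι, hs'θ]
  have hι'pq : ∀ p q : w.1.adicCompletion E, ι' (toPlace w.1 w₁ p + toPlace w.1 w₁ q * θ) = toPlace w.1 w₁ p + toPlace w.1 w₁ (-q) * θ := fun p q => by
    rw [map_add, map_mul, hι'j, hι'j, hι'θ, map_neg]; ring
  have hι'v : ∀ z, Valued.v (ι' z) = Valued.v z := fun z => by
    obtain ⟨pq, rfl⟩ := hco z
    rw [hι'pq, hval, hval, Valuation.map_neg]
  have hcomm : ∀ z, s' (ι' z) = ι' (s' z) := fun z => by
    obtain ⟨pq, rfl⟩ := hco z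
    rw [hι'pq, hs'pq, hs'pq, hι'pq, map_neg]
  -- `ι′`-fixed elements are `ι₁ p` (uniqueness of the Eisenstein coordinates; characteristic `0`)
  haveI : CharZero (w.1.adicCompletion E) := charZero_of_injective_algebraMap (algebraMap E (w.1.adicCompletion E)).injective
  have hfix : ∀ z : w₁.1.adicCompletion M, ι' z = z → ∃ p : w.1.adicCompletion E, z = toPlace w.1 w₁ p := by
    intro z hz
    obtain ⟨⟨p, q⟩, rfl⟩ := hco z
    have huniq := (hcoord (toPlace w.1 w₁ p + toPlace w.1 w₁ q * θ)).unique (y₁ := (p, q)) (y₂ := (p, -q)) rfl (by rw [← hι'pq p q, hz])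
    have hq : q = 0 := CharZero.eq_neg_self_iff.1 (congrArg Prod.snd huniq)
    exact ⟨p, by rw [hq, map_zero, zero_mul, add_zero]⟩
  -- (rE)
  have hrE : ∀ x : w₁.1.adicCompletion M, x ≠ 0 → ι' x = x → Even (WithZero.log (Valued.v x)) := by
    intro x hx0 hιx
    obtain ⟨p, rfl⟩ := hfix x hιx
    have hp0 : Valued.v p ≠ 0 := (Valuation.ne_zero_iff _).2 fun h => hx0 (by rw [h, map_zero])
    rw [hjv, ← WithZero.exp_log hp0, ← WithZero.exp_nsmul, WithZero.log_exp, two_nsmul]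
    exact ⟨_, rfl⟩
  -- unit norms at the INERT place, field level (★ `exists_mul_galAdicCompletionMap_eq_of_inert`)
  have hcc : c * c = 1 := algEquiv_mul_self_eq_one (F := F) hc
  have hunitE : ∀ x : 𝒪[w.1.adicCompletion E], IsUnit x ↔ Valued.v (x : w.1.adicCompletion E) = 1 := fun x => by
    rw [(Valuation.integer.integers (valuation (w.1.adicCompletion E))).isUnit_iff_valuation_eq_one, v_eq_one_iff_valuation_eq_one]; rfl
  have hnormU : ∀ u : w.1.adicCompletion E, Valued.v u = 1 → galAdicCompletionMap (L := E) c hw u = u →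
      ∃ t : w.1.adicCompletion E, t * galAdicCompletionMap (L := E) c hw t = u := by
    intro u hu1 hsu
    have huO : u ∈ 𝒪[w.1.adicCompletion E] := (v_le_one_iff_mem_integer u).1 hu1.le
    obtain ⟨t, ht⟩ := LocalFields.UnramifiedQuadraticNorm.exists_mul_galAdicCompletionMap_eq_of_inert c v hc hcc hunr w hw ⟨u, huO⟩ ((hunitE _).2 hu1) hsu
    exact ⟨t, ht⟩
  -- (nE)
  have hd0 : d ≠ 0 := fun h0 => by rw [h0, map_zero] at hd; exact WithZero.coe_ne_zero hd.symm
  have hnE : ∀ c₁ : w₁.1.adicCompletion M, c₁ ≠ 0 → s' c₁ = c₁ → ι' c₁ = c₁ → (4 : ℤ) ∣ WithZero.log (Valued.v c₁) →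
      ∃ a : w₁.1.adicCompletion M, ι' a = a ∧ a * s' a * c₁ = 1 := by
    intro c₁ hc0 hsc hιc h4
    obtain ⟨p, rfl⟩ := hfix c₁ hιc
    have hp0 : p ≠ 0 := fun h => hc0 (by rw [h, map_zero])
    have hvp0 : Valued.v p ≠ 0 := (Valuation.ne_zero_iff _).2 hp0
    have hsp : galAdicCompletionMap (L := E) c hw p = p := (toPlace w.1 w₁).injective (by rw [← hs'ι, hsc])
    -- `ord p` is even
    rw [hjv, ← WithZero.exp_log hvp0, ← WithZero.exp_nsmul, WithZero.log_exp] at h4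
    obtain ⟨k, hk⟩ : (2 : ℤ) ∣ WithZero.log (Valued.v p) := by
      obtain ⟨j, hj⟩ := h4; exact ⟨j, by simp only [nsmul_eq_mul, Nat.cast_ofNat] at hj; omega⟩
    -- `p = t·σ_w t` (★ (S2) on the inert unit norms, `x := d^{−k}`)
    obtain ⟨t, ht⟩ := Literature.NumberTheory.Automorphic.exists_mul_map_eq_of_valuation_eq Valued.v (galAdicCompletionMap (L := E) c hw) hss hnormU
      (d ^ (-k)) p hp0 hsp (by
        have hx : d ^ (-k) * galAdicCompletionMap (L := E) c hw (d ^ (-k)) = (d * d) ^ (-k) := by rw [map_zpow₀, hσd, mul_zpow]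
        rw [hx, map_zpow₀, map_mul, hd, ← WithZero.exp_add, ← WithZero.exp_zsmul, ← WithZero.exp_log hvp0, hk, WithZero.exp_inj, smul_eq_mul]
        ring)
    have ht0 : toPlace w.1 w₁ t ≠ 0 := fun h0 => by
      have ht0' : t = 0 := (map_eq_zero_iff _ (toPlace w.1 w₁).injective).1 h0
      exact hp0 (by rw [← ht, ht0', zero_mul])
    refine ⟨(toPlace w.1 w₁ t)⁻¹, by rw [map_inv₀, hι'j], ?_⟩
    rw [map_inv₀, hs'ι, ← mul_inv, ← map_mul, ht]
    exact inv_mul_cancel₀ (by rw [_root_.map_ne_zero]; exact hp0)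
  -- `|θ − ι′θ| = |2|_w² · |θ|`
  haveI : CharZero (w₁.1.adicCompletion M) := charZero_of_injective_algebraMap (algebraMap M (w₁.1.adicCompletion M)).injective
  have h2v : Valued.v (2 : w.1.adicCompletion E) ≤ 1 := by
    rw [← one_add_one_eq_two]; exact Valuation.map_add_le _ (by rw [map_one]) (by rw [map_one])
  have h20 : Valued.v (2 : w.1.adicCompletion E) ≠ 0 := (Valuation.ne_zero_iff _).2 two_ne_zero
  obtain ⟨s, hs⟩ : ∃ s : ℕ, Valued.v (2 : w.1.adicCompletion E) = WithZero.exp (-(s : ℤ)) := by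
    refine ⟨(-WithZero.log (Valued.v (2 : w.1.adicCompletion E))).toNat, ?_⟩
    rw [← WithZero.exp_log h20] at h2v ⊢
    rw [← WithZero.exp_zero, WithZero.exp_le_exp] at h2v
    rw [WithZero.exp_inj, WithZero.log_exp]; omega
  have hθs : Valued.v (θ - ι' θ) = WithZero.exp (-((2 * s + 1 : ℕ) : ℤ)) := by
    rw [hι'θ, sub_neg_eq_add, ← two_mul, show (2 : w₁.1.adicCompletion M) = toPlace w.1 w₁ 2 from (map_ofNat _ 2).symm, map_mul, hjv, hs, hθv,
      ← WithZero.exp_nsmul, ← WithZero.exp_add]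
    congr 1; push_cast; ring
  exact ⟨d₀, θ, s', ι', ⟨hd₀, hd₀v, h0, hθ, hθv, hcoord, hint, hs'ι, hs'θ, hs's', hs'O, hs'v, hnorm1⟩, ⟨hι'j, hι'θ, hι'ι', hι'O, hι'v, hcomm⟩, hrE, hnE, ⟨s, hθs⟩⟩

end Literature.NumberTheory.Rogawski1990
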